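import Literature.MathematicalPhysics.QuantumChemistry.SlaterCondonRulesStrings
import HarnessLib

/-!
# The Slater–Condon rules, IIIb: ON vectors differing in two pairs — (1.4.7), (1.4.24)

Part IIIb of the Slater–Condon rules of Helgaker–Jørgensen–Olsen (2000) §1.4.1–1.4.2 on the tree's
Jordan–Wigner Fock space (setting: `SlaterCondonRules.lean`; strings: `SlaterCondonRulesStrings.lean`).
Two replacements: `|k₁⟩ = |D⟩`, `K ≠ L` occupied, `I ≠ J` empty, `|k₂⟩ = |D ∖ {K,L} ∪ {I,J}⟩` reached by
the string `a†_I a†_J a_L a_K`: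

* `dGamma_apply_double` — `⟨k₂|f̂|k₁⟩ = 0` (the two-pair instance of **(1.4.7)**);
* `twoElectronOp_apply_double_general` — `± ½((g_IKJL − g_ILJK) − (g_JKIL − g_JLIK))`, no symmetry
  assumed (HJO's "exercise" after (1.4.36));
* `twoElectronOp_apply_double` / `twoElectronOp_apply_double'` — **(1.4.24)**
  `⟨k₂|ĝ|k₁⟩ = Γ_I^{k₂} Γ_J^{k₂} Γ_K^{k₁} Γ_L^{k₁} (g_IKJL − g_ILJK)` (primed: verbatim, `I < J`, `K < L`;
  unprimed: the phase met by the string, no order hypotheses).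

Method (HJO's): transfer along `W = a†_I a†_J a_L a_K`, move `a_J a_I` through the creators of the
two-electron string with (1.2.29) (double contraction; single contractions leave an annihilator that
kills `|k₁⟩`), and read off occupation numbers with the diagonal rule of part I. Everything is PROVED
(0 sorry); no definition, no named fact; helpers are `private` (some are private copies of helpers of
`SlaterCondonRulesStrings.lean`, which does not export them).

## References

* T. Helgaker, P. Jørgensen, J. Olsen, *Molecular Electronic-Structure Theory*, Wiley (2000), §1.2
  eqs. (1.2.3), (1.2.5), (1.2.16), (1.2.22), (1.2.29); §1.3.1 eq. (1.3.2); §1.4.1 eqs. (1.4.2)–(1.4.13);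
  §1.4.2 eqs. (1.4.14)–(1.4.38); §1.4.3 eq. (1.4.39); held copy
  `book:helgakernd-molecular-electronic-structure-theory` (chunks p0039–p0042, p0045–p0049 read
  2026-08-21). [cite: HelgakerJorgensenOlsen2000, §1.4.1–1.4.2]
* J. C. Slater, Phys. Rev. 34 (1929) 1293; E. U. Condon, Phys. Rev. 36 (1930) 1121 (the original
  rules; ref. [1] of HJO Ch. 1).
-/

noncomputable section

namespace Literature.MathematicalPhysics.QuantumChemistry

open Matrix Finset
open Literature.MathematicalPhysics.QuantumLattice

section SpinOrbital

variable {ι : Type*} [LinearOrder ι] [Fintype ι]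

/-- `X_{IJ} = (X |J⟩)_I` for the ON vector `|J⟩ = e_J` (plumbing). [folklore] -/
private theorem apply_eq_mulVec_single (X : Matrix (Finset ι) (Finset ι) ℂ) (I J : Finset ι) :
    X I J = (X *ᵥ Pi.single J (1 : ℂ)) I := by
  rw [mulVec_single_one, col_apply]

/-- **Transfer of a transition element to a diagonal one** (helper). If a string `W` of elementary
operators maps `|J⟩` to `s |I⟩` with a real sign `s` (`s̄ = s`, `s² = 1`), then
`⟨I| X |J⟩ = s ⟨J| W† X |J⟩` for every operator `X` (since `⟨I| = s ⟨J| W†`); this is how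
Helgaker–Jørgensen–Olsen evaluate (1.4.10) and (1.4.32)–(1.4.36). [folklore] -/
private theorem apply_eq_sign_mul_conjTranspose_mul_apply {W X : Matrix (Finset ι) (Finset ι) ℂ}
    {I J : Finset ι} {s : ℂ} (hW : W *ᵥ Pi.single J (1 : ℂ) = s • Pi.single I 1)
    (hs : star s = s) (hs1 : s * s = 1) :
    X I J = s * (Wᴴ * X) J J := by
  have hWK : ∀ K, W K J = s * (Pi.single I (1 : ℂ) : Fock ι) K := fun K => by
    rw [apply_eq_mulVec_single W K J, hW, Pi.smul_apply, smul_eq_mul]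
  have hK : ∀ K, star (W K J) * X K J = if I = K then s * X K J else 0 := by
    intro K
    rw [hWK, star_mul', hs]
    by_cases hKI : I = K
    · subst hKI
      rw [Pi.single_eq_same, star_one, mul_one, if_pos rfl]
    · rw [Pi.single_eq_of_ne' hKI, star_zero, mul_zero, zero_mul, if_neg hKI]
  rw [Matrix.mul_apply]
  simp_rw [conjTranspose_apply, hK, Finset.sum_ite_eq, Finset.mem_univ, if_true, ← mul_assoc, hs1,
    one_mul]

/-! ### Helpers (private copies) -/

/-- `M a_u |T⟩ = 0` if `u ∉ T` (helper). [folklore] -/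
private theorem mul_annihilation_mulVec_single_of_not_mem (M : Matrix (Finset ι) (Finset ι) ℂ) {u : ι}
    {T : Finset ι} (hu : u ∉ T) : (M * annihilation u) *ᵥ Pi.single T (1 : ℂ) = 0 := by
  rw [← mulVec_mulVec, annihilation_mulVec_single_of_not_mem hu, mulVec_zero]

/-- `M a_u a_z |J⟩ = 0` if `u ∉ J` (helper). [folklore] -/
private theorem mul_annihilation_annihilation_mulVec_single_of_not_mem (M : Matrix (Finset ι) (Finset ι) ℂ)
    {u : ι} (z : ι) {J : Finset ι} (hu : u ∉ J) :
    (M * annihilation u * annihilation z) *ᵥ Pi.single J (1 : ℂ) = 0 := by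
  rw [← mulVec_mulVec, annihilation_mulVec_single]
  split_ifs with hz
  · rw [mulVec_smul,
      mul_annihilation_mulVec_single_of_not_mem M (fun h => hu (mem_of_mem_erase h)), smul_zero]
  · rw [mulVec_zero]

/-- `M a_u a_y a_z |J⟩ = 0` if `u ∉ J` (helper). [folklore] -/
private theorem mul_annihilation_annihilation_annihilation_mulVec_single_of_not_mem
    (M : Matrix (Finset ι) (Finset ι) ℂ) {u : ι} (y z : ι) {J : Finset ι} (hu : u ∉ J) :
    (M * annihilation u * annihilation y * annihilation z) *ᵥ Pi.single J (1 : ℂ) = 0 := by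
  rw [← mulVec_mulVec, annihilation_mulVec_single]
  split_ifs with hz
  · rw [mulVec_smul, mul_annihilation_annihilation_mulVec_single_of_not_mem M y
      (fun h => hu (mem_of_mem_erase h)), smul_zero]
  · rw [mulVec_zero]

/-- Moving one annihilator through two creators onto a vector it kills (twice (1.2.29)):
`a_a a†_P a†_R u = δ_{aP} a†_R u − δ_{aR} a†_P u` if `a_a u = 0` (helper). [folklore] -/
private theorem annihilation_mulVec_creation_creation_of_kills {a P R : ι} {u : Fock ι}
    (hu : annihilation a *ᵥ u = 0) :
    annihilation a *ᵥ (creation P *ᵥ (creation R *ᵥ u)) =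
      (if a = P then (1 : ℂ) else 0) • (creation R *ᵥ u) -
        (if a = R then (1 : ℂ) else 0) • (creation P *ᵥ u) := by
  rw [annihilation_mulVec_creation_mulVec, annihilation_mulVec_creation_mulVec, hu, mulVec_zero,
    sub_zero, mulVec_smul]

/-- Moving two annihilators through two creators onto a vector they kill (the double
contraction): `a_J a_I a†_P a†_R u = (δ_{IP} δ_{JR} − δ_{IR} δ_{JP}) u` if `a_I u = a_J u = 0` (helper).
[folklore] -/
private theorem annihilation_annihilation_mulVec_creation_creation_of_kills {I J P R : ι} {u : Fock ι}
    (hI : annihilation I *ᵥ u = 0) (hJ : annihilation J *ᵥ u = 0) :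
    annihilation J *ᵥ (annihilation I *ᵥ (creation P *ᵥ (creation R *ᵥ u))) =
      ((if I = P then (1 : ℂ) else 0) * (if J = R then (1 : ℂ) else 0) -
        (if I = R then (1 : ℂ) else 0) * (if J = P then (1 : ℂ) else 0)) • u := by
  rw [annihilation_mulVec_creation_creation_of_kills hI, mulVec_sub, mulVec_smul, mulVec_smul,
    annihilation_mulVec_creation_mulVec J R u, annihilation_mulVec_creation_mulVec J P u, hJ,
    mulVec_zero, mulVec_zero, sub_zero, sub_zero, smul_smul, smul_smul, ← sub_smul]

/-! ### Two replacements: (1.4.7), (1.4.24) -/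

section Double

variable {I J K L : ι} {D : Finset ι}

/-- `⟨D| a†_K a†_L a_J a_I (a†_P a_Q) |D⟩ = 0` for `I, J` empty in `|D⟩`: a one-electron operator cannot
connect ON vectors differing in two pairs (towards Helgaker–Jørgensen–Olsen (1.4.7); helper).
[folklore] -/
private theorem double_oneString_apply (hI : I ∉ D) (hJ : J ∉ D) (K L P Q : ι) :
    (creation K * creation L * annihilation J * annihilation I * (creation P * annihilation Q)) D D =
      0 := by
  have hIu : annihilation I *ᵥ (annihilation Q *ᵥ Pi.single D (1 : ℂ)) = 0 := by
    rw [mulVec_mulVec, ← one_mul (annihilation I),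
      mul_annihilation_annihilation_mulVec_single_of_not_mem 1 Q hI]
  have hJu : annihilation J *ᵥ (annihilation Q *ᵥ Pi.single D (1 : ℂ)) = 0 := by
    rw [mulVec_mulVec, ← one_mul (annihilation J),
      mul_annihilation_annihilation_mulVec_single_of_not_mem 1 Q hJ]
  rw [apply_eq_mulVec_single (creation K * creation L * annihilation J * annihilation I * _) D D,
    show creation K * creation L * annihilation J * annihilation I * (creation P * annihilation Q) =
      creation K * (creation L * (annihilation J * (annihilation I * (creation P * annihilation Q))))
      by simp only [mul_assoc],
    ← mulVec_mulVec, ← mulVec_mulVec, ← mulVec_mulVec, ← mulVec_mulVec, ← mulVec_mulVec,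
    annihilation_mulVec_creation_mulVec, hIu, mulVec_zero, sub_zero, mulVec_smul, hJu, smul_zero,
    mulVec_zero, mulVec_zero, Pi.zero_apply]

/-- `⟨D| a†_K a†_L a_J a_I (a†_P a†_R a_S a_Q) |D⟩ = (δ_{IP}δ_{JR} − δ_{IR}δ_{JP}) ⟨D| a†_K a†_L a_S a_Q |D⟩`
for `I, J` empty in `|D⟩` (the double contraction; towards (1.4.24); helper). [folklore] -/
private theorem double_twoString_apply (hI : I ∉ D) (hJ : J ∉ D) (K L P Q R S : ι) :
    (creation K * creation L * annihilation J * annihilation I *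
        (creation P * creation R * annihilation S * annihilation Q)) D D =
      ((if I = P then (1 : ℂ) else 0) * (if J = R then (1 : ℂ) else 0) -
          (if I = R then (1 : ℂ) else 0) * (if J = P then (1 : ℂ) else 0)) *
        (creation K * creation L * annihilation S * annihilation Q) D D := by
  have hIu : annihilation I *ᵥ ((annihilation S * annihilation Q) *ᵥ Pi.single D (1 : ℂ)) = 0 := by
    rw [mulVec_mulVec, ← one_mul (annihilation I), ← mul_assoc,
      mul_annihilation_annihilation_annihilation_mulVec_single_of_not_mem 1 S Q hI]
  have hJu : annihilation J *ᵥ ((annihilation S * annihilation Q) *ᵥ Pi.single D (1 : ℂ)) = 0 := by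
    rw [mulVec_mulVec, ← one_mul (annihilation J), ← mul_assoc,
      mul_annihilation_annihilation_annihilation_mulVec_single_of_not_mem 1 S Q hJ]
  rw [apply_eq_mulVec_single (creation K * creation L * annihilation J * annihilation I * _) D D,
    show creation K * creation L * annihilation J * annihilation I *
        (creation P * creation R * annihilation S * annihilation Q) =
      creation K * (creation L * (annihilation J * (annihilation I * (creation P * (creation R *
        (annihilation S * annihilation Q)))))) by simp only [mul_assoc],
    ← mulVec_mulVec, ← mulVec_mulVec, ← mulVec_mulVec, ← mulVec_mulVec, ← mulVec_mulVec,
    ← mulVec_mulVec, annihilation_annihilation_mulVec_creation_creation_of_kills hIu hJu, mulVec_smul,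
    mulVec_smul, Pi.smul_apply, smul_eq_mul]
  simp only [mulVec_mulVec, ← mul_assoc, ← apply_eq_mulVec_single]

/-- Collapsing the diagonal two-electron string under a double sum (the patterns of
Helgaker–Jørgensen–Olsen (1.4.28) with both creation indices fixed; helper):
`Σ_{QS} G_{QS} ⟨D| a†_K a†_L a_S a_Q |D⟩ = G_{KL} − G_{LK}` for `K, L ∈ D`. [folklore] -/
private theorem sum_sum_mul_twoElectronString_apply_self (G : ι → ι → ℂ) (hK : K ∈ D) (hL : L ∈ D) :
    ∑ Q, ∑ S, G Q S * (creation K * creation L * annihilation S * annihilation Q) D D =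
      G K L - G L K := by
  have h1 : ∀ Q S, G Q S * (creation K * creation L * annihilation S * annihilation Q) D D =
      (if K = Q then (if L = S then G Q S else 0) else 0) -
        (if K = S then (if L = Q then G Q S else 0) else 0) := by
    intro Q S
    rw [twoElectronString_apply_self', mul_sub]
    congr 1
    · by_cases hQ : K = Q
      · subst hQ
        by_cases hS : L = S
        · subst hS; simp [hK, hL]
        · simp [hS]
      · simp [hQ]
    · by_cases hS : K = S
      · subst hS
        by_cases hQ : L = Q
        · subst hQ; simp [hK, hL]
        · simp [hQ]
      · simp [hS]
  simp only [h1, Finset.sum_sub_distrib, Finset.sum_ite_irrel, Finset.sum_const_zero,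
    Finset.sum_ite_eq, Finset.mem_univ, if_true]

omit [Fintype ι] in
/-- The double-replacement phase met by `a†_I a†_J a_L a_K` on `|D⟩` (product of four Jordan–Wigner
phases, Helgaker–Jørgensen–Olsen (2000) eq. (1.2.3)) is real (helper). [folklore] -/
private theorem star_dsgn (I J K L : ι) (D : Finset ι) :
    star (jwSign K D * jwSign L (D.erase K) * jwSign J ((D.erase K).erase L) *
      jwSign I (insert J ((D.erase K).erase L))) =
      jwSign K D * jwSign L (D.erase K) * jwSign J ((D.erase K).erase L) *
      jwSign I (insert J ((D.erase K).erase L)) := by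
  simp only [star_mul', star_jwSign]

omit [Fintype ι] in
/-- The double-replacement phase squares to one (helper). [folklore] -/
private theorem dsgn_mul_self (I J K L : ι) (D : Finset ι) :
    jwSign K D * jwSign L (D.erase K) * jwSign J ((D.erase K).erase L) *
      jwSign I (insert J ((D.erase K).erase L)) *
      (jwSign K D * jwSign L (D.erase K) * jwSign J ((D.erase K).erase L) *
      jwSign I (insert J ((D.erase K).erase L))) = 1 := by
  have h1 := jwSign_mul_self K D
  have h2 := jwSign_mul_self L (D.erase K)
  have h3 := jwSign_mul_self J ((D.erase K).erase L)
  have h4 := jwSign_mul_self I (insert J ((D.erase K).erase L))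
  linear_combination (jwSign L (D.erase K) * jwSign L (D.erase K) *
      (jwSign J ((D.erase K).erase L) * jwSign J ((D.erase K).erase L)) *
      (jwSign I (insert J ((D.erase K).erase L)) * jwSign I (insert J ((D.erase K).erase L)))) * h1 +
    (jwSign J ((D.erase K).erase L) * jwSign J ((D.erase K).erase L) *
      (jwSign I (insert J ((D.erase K).erase L)) * jwSign I (insert J ((D.erase K).erase L)))) * h2 +
    (jwSign I (insert J ((D.erase K).erase L)) * jwSign I (insert J ((D.erase K).erase L))) * h3 + h4

/-- `(a†_I a†_J a_L a_K)† = a†_K a†_L a_J a_I` (helper). [folklore] -/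
private theorem conjTranspose_doubleString (I J K L : ι) :
    (creation I * creation J * annihilation L * annihilation K)ᴴ =
      creation K * creation L * annihilation J * annihilation I := by
  simp only [conjTranspose_mul, annihilation_conjTranspose, creation_conjTranspose, mul_assoc]

/-- **One-electron operator between ON vectors differing in two pairs vanishes** (the double-
replacement instance of Helgaker–Jørgensen–Olsen (2000) eq. (1.4.7); the general statement is
`dGamma_apply_eq_zero_of`). [cite: HelgakerJorgensenOlsen2000, eq. (1.4.7)] -/
theorem dGamma_apply_double (f : Matrix ι ι ℂ) (hK : K ∈ D) (hL : L ∈ D) (hKL : K ≠ L)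
    (hI : I ∉ D) (hJ : J ∉ D) (hIJ : I ≠ J) :
    dGamma f (insert I (insert J ((D.erase K).erase L))) D = 0 := by
  rw [apply_eq_sign_mul_conjTranspose_mul_apply (X := dGamma f)
    (doubleString_mulVec_single hK hL hKL hI hJ hIJ) (star_dsgn I J K L D) (dsgn_mul_self I J K L D),
    conjTranspose_doubleString, dGamma_eq]
  simp only [Finset.mul_sum, Matrix.mul_smul, Matrix.sum_apply, Matrix.smul_apply, smul_eq_mul,
    double_oneString_apply hI hJ, mul_zero, Finset.sum_const_zero]

/-- **Two-electron operator, ON vectors differing in two pairs, general integrals**: for `K ≠ L`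
occupied and `I ≠ J` empty in `|k₁⟩ = |D⟩` and `|k₂⟩ = a†_I a†_J a_L a_K |k₁⟩` (up to its phase),
`⟨k₂| ĝ |k₁⟩ = ± ½ ((g_{IKJL} − g_{ILJK}) − (g_{JKIL} − g_{JLIK}))` with NO permutational symmetry
assumed on `g` (the exercise after Helgaker–Jørgensen–Olsen (2000) eq. (1.4.36)).
[cite: HelgakerJorgensenOlsen2000, eq. (1.4.24)] -/
theorem twoElectronOp_apply_double_general (g : ι → ι → ι → ι → ℂ) (hK : K ∈ D) (hL : L ∈ D)
    (hKL : K ≠ L) (hI : I ∉ D) (hJ : J ∉ D) (hIJ : I ≠ J) :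
    twoElectronOp g (insert I (insert J ((D.erase K).erase L))) D =
      jwSign K D * jwSign L (D.erase K) * jwSign J ((D.erase K).erase L) *
          jwSign I (insert J ((D.erase K).erase L)) *
        ((1 / 2 : ℂ) * ((g I K J L - g I L J K) - (g J K I L - g J L I K))) := by
  rw [apply_eq_sign_mul_conjTranspose_mul_apply (X := twoElectronOp g)
    (doubleString_mulVec_single hK hL hKL hI hJ hIJ) (star_dsgn I J K L D) (dsgn_mul_self I J K L D),
    conjTranspose_doubleString]
  congr 1
  rw [twoElectronOp, Matrix.mul_smul, Matrix.smul_apply, smul_eq_mul]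
  congr 1
  rw [show (creation K * creation L * annihilation J * annihilation I * ∑ P, ∑ Q, ∑ R, ∑ S,
      g P Q R S • (creation P * creation R * annihilation S * annihilation Q)) D D =
      ∑ P, ∑ Q, ∑ R, ∑ S, g P Q R S * (creation K * creation L * annihilation J * annihilation I *
        (creation P * creation R * annihilation S * annihilation Q)) D D
      by simp only [Finset.mul_sum, Matrix.mul_smul, Matrix.sum_apply, Matrix.smul_apply, smul_eq_mul]]
  have hsplit : ∑ P, ∑ Q, ∑ R, ∑ S, g P Q R S * (creation K * creation L * annihilation J *
      annihilation I * (creation P * creation R * annihilation S * annihilation Q)) D D =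
      (∑ P, ∑ Q, ∑ R, ∑ S, g P Q R S * ((if I = P then (1 : ℂ) else 0) *
        (if J = R then (1 : ℂ) else 0) *
          (creation K * creation L * annihilation S * annihilation Q) D D)) -
      ∑ P, ∑ Q, ∑ R, ∑ S, g P Q R S * ((if I = R then (1 : ℂ) else 0) *
        (if J = P then (1 : ℂ) else 0) *
          (creation K * creation L * annihilation S * annihilation Q) D D) := by
    simp only [double_twoString_apply hI hJ, sub_mul, mul_sub, Finset.sum_sub_distrib]
  -- pointwise normal form of a doubly-gated term
  have hgate : ∀ (p q : Prop) [Decidable p] [Decidable q] (c E : ℂ),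
      c * ((if p then (1 : ℂ) else 0) * (if q then (1 : ℂ) else 0) * E) =
        if p then (if q then c * E else 0) else 0 := by
    intro p q _ _ c E
    split_ifs <;> simp
  have h1 : ∑ P, ∑ Q, ∑ R, ∑ S, g P Q R S * ((if I = P then (1 : ℂ) else 0) *
      (if J = R then (1 : ℂ) else 0) *
        (creation K * creation L * annihilation S * annihilation Q) D D) = g I K J L - g I L J K := by
    simp only [hgate, Finset.sum_ite_irrel, Finset.sum_const_zero, Finset.sum_ite_eq,
      Finset.mem_univ, if_true]
    exact sum_sum_mul_twoElectronString_apply_self (fun Q S => g I Q J S) hK hL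
  have h2 : ∑ P, ∑ Q, ∑ R, ∑ S, g P Q R S * ((if I = R then (1 : ℂ) else 0) *
      (if J = P then (1 : ℂ) else 0) *
        (creation K * creation L * annihilation S * annihilation Q) D D) = g J K I L - g J L I K := by
    simp only [hgate, Finset.sum_ite_irrel, Finset.sum_const_zero, Finset.sum_ite_eq,
      Finset.mem_univ, if_true]
    exact sum_sum_mul_twoElectronString_apply_self (fun Q S => g J Q I S) hK hL
  rw [hsplit, h1, h2]

/-- **Two-electron operator, ON vectors differing in two pairs** — Helgaker–Jørgensen–Olsen (2000)
eq. (1.4.24) with the phase written as met by the string `a†_I a†_J a_L a_K`: under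
`g_{PQRS} = g_{RSPQ}` (1.4.17), `⟨k₂| ĝ |k₁⟩ = ± (g_{IKJL} − g_{ILJK})`. See
`twoElectronOp_apply_double'` for the phase `Γ_I^{k₂} Γ_J^{k₂} Γ_K^{k₁} Γ_L^{k₁}` as printed.
[cite: HelgakerJorgensenOlsen2000, eq. (1.4.24)] -/
theorem twoElectronOp_apply_double (g : ι → ι → ι → ι → ℂ) (hg : ∀ P Q R S, g P Q R S = g R S P Q)
    (hK : K ∈ D) (hL : L ∈ D) (hKL : K ≠ L) (hI : I ∉ D) (hJ : J ∉ D) (hIJ : I ≠ J) :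
    twoElectronOp g (insert I (insert J ((D.erase K).erase L))) D =
      jwSign K D * jwSign L (D.erase K) * jwSign J ((D.erase K).erase L) *
          jwSign I (insert J ((D.erase K).erase L)) * (g I K J L - g I L J K) := by
  rw [twoElectronOp_apply_double_general g hK hL hKL hI hJ hIJ, ← hg I L J K, ← hg I K J L]
  ring

/-- **Two-electron operator, ON vectors differing in two pairs** — Helgaker–Jørgensen–Olsen (2000)
eq. (1.4.24) verbatim: for `I < J` empty and `K < L` occupied in `|k₁⟩`, `|k₂⟩` the ON vector with
`I, J` filled and `K, L` emptied, and `g_{PQRS} = g_{RSPQ}`,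
`⟨k₂| ĝ |k₁⟩ = Γ_I^{k₂} Γ_J^{k₂} Γ_K^{k₁} Γ_L^{k₁} (g_{IKJL} − g_{ILJK})` (`Γ_P^{k} = jwSign P k`,
eq. (1.2.3)). [cite: HelgakerJorgensenOlsen2000, eq. (1.4.24)] -/
theorem twoElectronOp_apply_double' (g : ι → ι → ι → ι → ℂ) (hg : ∀ P Q R S, g P Q R S = g R S P Q)
    (hK : K ∈ D) (hL : L ∈ D) (hKL : K < L) (hI : I ∉ D) (hJ : J ∉ D) (hIJ : I < J) :
    twoElectronOp g (insert I (insert J ((D.erase K).erase L))) D =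
      jwSign I (insert I (insert J ((D.erase K).erase L))) *
        jwSign J (insert I (insert J ((D.erase K).erase L))) * jwSign K D * jwSign L D *
        (g I K J L - g I L J K) := by
  have hIT : I ∉ insert J ((D.erase K).erase L) := by
    rw [mem_insert, not_or]
    exact ⟨hIJ.ne, fun h => hI (mem_of_mem_erase (mem_of_mem_erase h))⟩
  rw [twoElectronOp_apply_double g hg hK hL hKL.ne hI hJ hIJ.ne,
    jwSign_insert_of_not_lt (lt_irrefl I), jwSign_insert_of_lt hIT hIJ,
    jwSign_insert_of_not_lt (lt_irrefl J), jwSign_erase_of_lt hK hKL]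
  ring

end Double

end SpinOrbital

end Literature.MathematicalPhysics.QuantumChemistry
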